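import Mathlib
import HarnessLib

/-!
# The g.c.d. of `aⁿ − 1` and `bⁿ − 1` — the objects of the proof (definitions)

Companion to `IntegerGCDBound.lean`, which states the named fact
`Literature.NumberTheory.DiophantineGeometry.BugeaudCorvajaZannier2003_thm1` (Bugeaud–Corvaja–Zannier,
Math. Z. 243 (2003), Thm. 1 [BugeaudCorvajaZannier2003]: for multiplicatively independent
`a, b ≥ 2`, `gcd(aⁿ − 1, bⁿ − 1) ≤ exp(εn)` for large `n`). The theorem is "a consequence of
Schmidt's Subspace Theorem"; the files `IntegerGCDBound{Defs, ExpPolyProofs, VectorsProofs,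
Proofs}.lean` formalise that deduction COMPLETELY, following the proof printed in Bombieri–Gubler,
*Heights in Diophantine Geometry* (2006), Thm. 7.4.10, pp. 218–220 [BombieriGubler2006]
(= Corvaja–Zannier [CorvajaZannier2002]; B–G 7.4.9: "a theorem in arithmetic, due to Corvaja and
Zannier"), specialised to the pairs `(u, v) = (aⁿ, bⁿ)`, and ending in
`BugeaudCorvajaZannier2003_thm1_of_subspaceTheorem` (`IntegerGCDBoundProofs.lean`): the `p`-adic
affine Subspace Theorem over `ℚ` (B–G Cor. 7.2.5 with `K = ℚ`) implies
`BugeaudCorvajaZannier2003_thm1`.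

This file fixes the OBJECTS of B–G's proof (p. 219), for `a, b, k, h, n : ℕ`, `u = aⁿ`, `v = bⁿ`:

* `gcdPow a b n = gcd(aⁿ − 1, bⁿ − 1)` (`g`); `dCoef a b n = (bⁿ − 1)/g` (B–G's `d`, the
  denominator of `(u − 1)/(v − 1)`); `cCoef a b n i = a^{in}(aⁿ − 1)/g` (B–G's integers
  `c_j = d z_j`, `z_j = u^{j−1}(u − 1)/(v − 1)`, with `i = j − 1`);
* the index type `Fin k ⊕ (Fin (k+1) × Fin h)` of B–G's `n = k + (k+1)h` variables
  `X = (W_1, …, W_k, Y_{01}, …, Y_{0h}, …, Y_{k1}, …, Y_{kh})` (`0`-based: `W i ↔ W_{i+1}`,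
  `Y (j, r) ↔ Y_{j, r+1}`);
* `xVec a b k h n`, B–G's integer point
  `x = d v^h (z_1, …, z_k, v^{-1}, …, v^{-h}, u v^{-1}, …, u^k v^{-h})`:
  `x_{W i} = v^h c_i`, `x_{Y j r} = d u^j v^{h-1-r}`;
* `formInf k h`, the linear forms at `∞`: `L_{∞ i} = W_i + Σ_r Y_{i−1,r} − Σ_r Y_{ir}` (`i ≤ k`)
  and `L_{∞ i} = X_i` otherwise; `formFin k h p`, the forms at a prime `p`: `L_{p i} = X_i`
  (forms are coefficient vectors, `L(x) = Σ_j L_j x_j`, the format of the Subspace hypothesis);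
* `relPoly k h f ∈ ℚ[U, V]`, the polynomial `V^h (U−1) Σ_i f_{W i} U^i + (V−1) Σ f_{Y j r} U^j V^{h−1−r}`
  which is `g · Σ_m f_m x_m` at `(U, V) = (aⁿ, bⁿ)` (B–G p. 220: "a non-trivial equation of type
  `f(u)/(v−1) + g(u,v)/v^h = 0`", cleared of denominators),

with their elementary API (exact divisions `d g = bⁿ − 1`, `c_i g = a^{in}(aⁿ − 1)`, positivity,
the crude bounds `d < bⁿ`, `c_i < a^{(i+1)n}`, the values of the forms, `eval_relPoly`).

## References

* [BombieriGubler2006] E. Bombieri, W. Gubler, *Heights in Diophantine Geometry*, New Mathematical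
  Monographs 4, CUP 2006, Thm. 7.4.10 and its proof (pp. 218–220), Cor. 7.2.5.
* [BugeaudCorvajaZannier2003] Y. Bugeaud, P. Corvaja, U. Zannier, *An upper bound for the G.C.D.
  of `aⁿ − 1` and `bⁿ − 1`*, Math. Z. 243 (2003), 79–84, Thm. 1.
* [CorvajaZannier2002] P. Corvaja, U. Zannier, *On the greatest prime factor of `(ab+1)(ac+1)`*,
  Proc. Amer. Math. Soc. 131 (2003), 1705–1709.
-/

namespace Literature.NumberTheory.DiophantineGeometry

namespace BugeaudCorvajaZannier2003

open Finset MvPolynomial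

/-! ### The integers `g`, `d`, `c_i` -/

/-- `g = gcd(aⁿ − 1, bⁿ − 1)`. [cite: BugeaudCorvajaZannier2003, Thm. 1] -/
def gcdPow (a b n : ℕ) : ℕ := Nat.gcd (a ^ n - 1) (b ^ n - 1)

/-- `d = (bⁿ − 1)/g`, the denominator of `(aⁿ − 1)/(bⁿ − 1)` in lowest terms (B–G's `d`,
with `u = aⁿ`, `v = bⁿ`). [cite: BombieriGubler2006, proof of Thm. 7.4.10] -/
def dCoef (a b n : ℕ) : ℕ := (b ^ n - 1) / gcdPow a b n

/-- `c_i = a^{in}(aⁿ − 1)/g` (B–G's integer `c_{i+1} = d z_{i+1}`, `z_j = u^{j-1}(u-1)/(v-1)`).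
[cite: BombieriGubler2006, proof of Thm. 7.4.10] -/
def cCoef (a b n i : ℕ) : ℕ := a ^ (i * n) * (a ^ n - 1) / gcdPow a b n

section Arith

variable {a b : ℕ} (ha : 2 ≤ a) (hb : 2 ≤ b) {n : ℕ} (hn : 1 ≤ n)
include ha hn in
/-- `aⁿ − 1 ≥ 1`. [folklore] -/
theorem one_le_pow_sub_one : 1 ≤ a ^ n - 1 := by
  have : 2 ≤ a ^ n := by
    calc 2 ≤ a := ha
      _ = a ^ 1 := (pow_one a).symm
      _ ≤ a ^ n := Nat.pow_le_pow_right (by omega) hn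
  omega

/-- `g ∣ aⁿ − 1`. [folklore] -/
theorem gcdPow_dvd_left (a b n : ℕ) : gcdPow a b n ∣ a ^ n - 1 := Nat.gcd_dvd_left _ _

/-- `g ∣ bⁿ − 1`. [folklore] -/
theorem gcdPow_dvd_right (a b n : ℕ) : gcdPow a b n ∣ b ^ n - 1 := Nat.gcd_dvd_right _ _

include ha hn in
/-- `g ≥ 1`. [folklore] -/
theorem gcdPow_pos : 0 < gcdPow a b n :=
  Nat.gcd_pos_of_pos_left _ (one_le_pow_sub_one ha hn)

/-- `d · g = bⁿ − 1`. [cite: BombieriGubler2006, proof of Thm. 7.4.10] -/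
theorem dCoef_mul_gcdPow (a b n : ℕ) : dCoef a b n * gcdPow a b n = b ^ n - 1 :=
  Nat.div_mul_cancel (gcdPow_dvd_right a b n)

/-- `c_i · g = a^{in}(aⁿ − 1)`. [cite: BombieriGubler2006, proof of Thm. 7.4.10] -/
theorem cCoef_mul_gcdPow (a b n i : ℕ) :
    cCoef a b n i * gcdPow a b n = a ^ (i * n) * (a ^ n - 1) :=
  Nat.div_mul_cancel (Dvd.dvd.mul_left (gcdPow_dvd_left a b n) _)

include hb hn in
/-- `d ≥ 1`. [folklore] -/
theorem dCoef_pos : 0 < dCoef a b n := by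
  have h1 := dCoef_mul_gcdPow a b n
  have h2 := one_le_pow_sub_one hb hn
  rcases Nat.eq_zero_or_pos (dCoef a b n) with h0 | h0
  · rw [h0, zero_mul] at h1; omega
  · exact h0

include ha hn in
/-- `c_i ≥ 1`. [folklore] -/
theorem cCoef_pos (i : ℕ) : 0 < cCoef a b n i := by
  have h1 := cCoef_mul_gcdPow a b n i
  have h2 := one_le_pow_sub_one ha hn
  have h3 : 0 < a ^ (i * n) := Nat.pow_pos (by omega)
  rcases Nat.eq_zero_or_pos (cCoef a b n i) with h0 | h0
  · rw [h0, zero_mul] at h1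
    have : 0 < a ^ (i * n) * (a ^ n - 1) := Nat.mul_pos h3 (by omega)
    omega
  · exact h0

include ha in
/-- Cast form of `cCoef_mul_gcdPow` in a characteristic-zero field. [folklore] -/
theorem cCoef_mul_gcdPow_cast {K : Type*} [Field K] [CharZero K] (i : ℕ) :
    (cCoef a b n i : K) * (gcdPow a b n : K) = (a : K) ^ (i * n) * ((a : K) ^ n - 1) := by
  have h1 := cCoef_mul_gcdPow a b n i
  have h2 : 1 ≤ a ^ n := Nat.one_le_pow _ _ (by omega)
  have h3 : ((a ^ n - 1 : ℕ) : K) = (a : K) ^ n - 1 := by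
    rw [Nat.cast_sub h2]; push_cast; ring
  rw [← h3]; exact_mod_cast h1

include hb in
/-- Cast form of `dCoef_mul_gcdPow` in a characteristic-zero field. [folklore] -/
theorem dCoef_mul_gcdPow_cast {K : Type*} [Field K] [CharZero K] :
    (dCoef a b n : K) * (gcdPow a b n : K) = (b : K) ^ n - 1 := by
  have h1 := dCoef_mul_gcdPow a b n
  have h2 : 1 ≤ b ^ n := Nat.one_le_pow _ _ (by omega)
  have h3 : ((b ^ n - 1 : ℕ) : K) = (b : K) ^ n - 1 := by
    rw [Nat.cast_sub h2]; push_cast; ring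
  rw [← h3]; exact_mod_cast h1

include hb in
/-- `d < bⁿ` (indeed `d ≤ bⁿ − 1`). [cite: BombieriGubler2006, proof of Thm. 7.4.10] -/
theorem dCoef_lt : dCoef a b n < b ^ n := by
  have h1 := dCoef_mul_gcdPow a b n
  have h2 : 1 ≤ b ^ n := Nat.one_le_pow _ _ (by omega)
  rcases Nat.eq_zero_or_pos (gcdPow a b n) with h0 | h0
  · -- degenerate (`n = 0`): then `d = (bⁿ-1)/0 = 0`
    simp only [dCoef, h0, Nat.div_zero]; omega
  · have : dCoef a b n ≤ dCoef a b n * gcdPow a b n := Nat.le_mul_of_pos_right _ h0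
    omega

include ha in
/-- `c_i < a^{(i+1)n}` (indeed `c_i ≤ a^{in}(aⁿ − 1)`). [cite: BombieriGubler2006, proof of Thm. 7.4.10] -/
theorem cCoef_lt (i : ℕ) : cCoef a b n i < a ^ ((i + 1) * n) := by
  have h1 := cCoef_mul_gcdPow a b n i
  have h2 : 1 ≤ a ^ n := Nat.one_le_pow _ _ (by omega)
  have h4 : a ^ (i * n) * (a ^ n - 1) < a ^ ((i + 1) * n) := by
    have h5 : 0 < a ^ (i * n) := Nat.pow_pos (by omega)
    calc a ^ (i * n) * (a ^ n - 1) < a ^ (i * n) * a ^ n := (Nat.mul_lt_mul_left h5).mpr (by omega)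
      _ = a ^ ((i + 1) * n) := by rw [← pow_add]; congr 1; ring
  rcases Nat.eq_zero_or_pos (gcdPow a b n) with h0 | h0
  · simp only [cCoef, h0, Nat.div_zero]; exact Nat.pow_pos (by omega)
  · have : cCoef a b n i ≤ cCoef a b n i * gcdPow a b n := Nat.le_mul_of_pos_right _ h0
    omega

end Arith

/-! ### The point `x` and the linear forms -/

/-- B–G's integer point `x = d v^h (z_1, …, z_k, (u^j v^{-r})_{j,r})`, `u = aⁿ`, `v = bⁿ`:
`x_{W i} = v^h c_i` (`i < k`), `x_{Y j r} = d u^j v^{h-1-r}` (`j ≤ k`, `r < h`).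
[cite: BombieriGubler2006, proof of Thm. 7.4.10] -/
def xVec (a b k h n : ℕ) : Fin k ⊕ (Fin (k + 1) × Fin h) → ℤ
  | Sum.inl i => ((b ^ (h * n) * cCoef a b n i : ℕ) : ℤ)
  | Sum.inr jr => ((dCoef a b n * (a ^ ((jr.1 : ℕ) * n) * b ^ ((h - 1 - (jr.2 : ℕ)) * n)) : ℕ) : ℤ)

/-- B–G's linear forms at the place `∞` (as coefficient vectors):
`L_{∞, W i} = W_i + Σ_r Y_{i, r} − Σ_r Y_{i+1, r}` (`0`-based `i < k`; B–G's
`W_i + Σ_r Y_{i−1,r} − Σ_r Y_{ir}`), and `L_{∞, Y j r} = Y_{j r}`.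
[cite: BombieriGubler2006, proof of Thm. 7.4.10] -/
def formInf (k h : ℕ) :
    (Fin k ⊕ (Fin (k + 1) × Fin h)) → (Fin k ⊕ (Fin (k + 1) × Fin h)) → ℚ
  | Sum.inl i => fun m =>
      (if m = Sum.inl i then 1 else 0) +
        (∑ r : Fin h, if m = Sum.inr (Fin.castSucc i, r) then 1 else 0) -
        ∑ r : Fin h, if m = Sum.inr (Fin.succ i, r) then 1 else 0
  | Sum.inr jr => fun m => if m = Sum.inr jr then 1 else 0

/-- B–G's linear forms at the finite places: the coordinate forms, `L_{p, m} = X_m` (the same for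
every prime `p`). [cite: BombieriGubler2006, proof of Thm. 7.4.10] -/
def formFin (k h : ℕ) (_p : ℕ) :
    (Fin k ⊕ (Fin (k + 1) × Fin h)) → (Fin k ⊕ (Fin (k + 1) × Fin h)) → ℚ :=
  fun m m' => if m' = m then 1 else 0

section Forms

variable (k h : ℕ)

/-- Value of a coordinate form. [folklore] -/
theorem formFin_apply (p : ℕ) (m : Fin k ⊕ (Fin (k + 1) × Fin h))
    (y : Fin k ⊕ (Fin (k + 1) × Fin h) → ℚ) : ∑ j, formFin k h p m j * y j = y m := by
  simp [formFin, ite_mul, Finset.sum_ite_eq']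

/-- Value of `L_{∞, Y j r}` (a coordinate form). [folklore] -/
theorem formInf_inr_apply (jr : Fin (k + 1) × Fin h) (y : Fin k ⊕ (Fin (k + 1) × Fin h) → ℚ) :
    ∑ j, formInf k h (Sum.inr jr) j * y j = y (Sum.inr jr) := by
  simp [formInf, ite_mul, Finset.sum_ite_eq']

/-- Value of `L_{∞, W i} = W_i + Σ_r Y_{i,r} − Σ_r Y_{i+1,r}`. [folklore] -/
theorem formInf_inl_apply (i : Fin k) (y : Fin k ⊕ (Fin (k + 1) × Fin h) → ℚ) :
    ∑ j, formInf k h (Sum.inl i) j * y j =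
      y (Sum.inl i) + ∑ r : Fin h, y (Sum.inr (Fin.castSucc i, r)) -
        ∑ r : Fin h, y (Sum.inr (Fin.succ i, r)) := by
  simp only [formInf, add_mul, sub_mul, Finset.sum_add_distrib, Finset.sum_sub_distrib,
    Finset.sum_mul, ite_mul, one_mul, zero_mul, Finset.sum_ite_eq', Finset.mem_univ, if_true]
  congr 1
  · congr 1
    rw [Finset.sum_comm]
    simp [Finset.sum_ite_eq']
  · rw [Finset.sum_comm]
    simp [Finset.sum_ite_eq']


end Forms

/-! ### The relation polynomial of B–G's proof of Thm. 7.4.10 -/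

section RelPoly

variable (k h : ℕ)

/-- The polynomial `V^h (U − 1) · Σ_{i<k} f_{W i} U^i + (V − 1) · Σ_{j ≤ k, r < h} f_{Y j r} U^j V^{h-1-r}`
in `ℚ[U, V] = MvPolynomial (Fin 2) ℚ` (`U = X 0`, `V = X 1`) attached to a coefficient vector `f`
on B–G's variables `W_i` (`i = 1, …, k`, here `Fin k`) and `Y_{jr}` (`0 ≤ j ≤ k`, `1 ≤ r ≤ h`, here
`Fin (k+1) × Fin h` with `r ↦ r + 1`, so the exponent `h − r` of B–G becomes `h − 1 − r`). It is
`g ·` (the relation `Σ_m f_m x_m`) evaluated at `(U, V) = (aⁿ, bⁿ)` (B–G p. 220, "a non-trivial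
equation of type `f(u)/(v−1) + g(u,v)/v^h = 0`", cleared of denominators).
[cite: BombieriGubler2006, proof of Thm. 7.4.10] -/
noncomputable def relPoly (f : Fin k ⊕ (Fin (k + 1) × Fin h) → ℚ) : MvPolynomial (Fin 2) ℚ :=
  X 1 ^ h * (X 0 - 1) * ∑ i : Fin k, monomial (Finsupp.single 0 (i : ℕ)) (f (Sum.inl i)) +
    (X 1 - 1) * ∑ jr : Fin (k + 1) × Fin h,
      monomial (Finsupp.single 0 (jr.1 : ℕ) + Finsupp.single 1 (h - 1 - (jr.2 : ℕ)))
        (f (Sum.inr jr))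

/-- Evaluation of `relPoly` at a point `(u, v)`. [cite: BombieriGubler2006, proof of Thm. 7.4.10] -/
theorem eval_relPoly (f : Fin k ⊕ (Fin (k + 1) × Fin h) → ℚ) (u v : ℚ) :
    MvPolynomial.eval ![u, v] (relPoly k h f) =
      v ^ h * (u - 1) * ∑ i : Fin k, f (Sum.inl i) * u ^ (i : ℕ) +
        (v - 1) * ∑ jr : Fin (k + 1) × Fin h,
          f (Sum.inr jr) * u ^ (jr.1 : ℕ) * v ^ (h - 1 - (jr.2 : ℕ)) := by
  classical
  simp only [relPoly, map_add, map_mul, map_pow, map_sub, map_one, map_sum, MvPolynomial.eval_X,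
    MvPolynomial.eval_monomial, Matrix.cons_val_zero, Matrix.cons_val_one]
  congr 1
  · congr 1
    refine Finset.sum_congr rfl fun i _ => ?_
    rw [Finsupp.prod_single_index (by simp)]
    simp
  · congr 1
    refine Finset.sum_congr rfl fun jr _ => ?_
    rw [Finsupp.prod_add_index' (by simp) (by simp [pow_add]),
      Finsupp.prod_single_index (by simp), Finsupp.prod_single_index (by simp)]
    simp [mul_assoc]


end RelPoly

end BugeaudCorvajaZannier2003

end Literature.NumberTheory.DiophantineGeometry
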